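import Summits.HubbardSuperconductivity.HubbardSuperconductivity.Theorems.AnisotropyChordTransferFibre3ShellCoercive

/-!
# Route `AnisotropyChord` / H0 rotor rung: the GM₃ assembly with a GENERAL shell constant, and the SMALL-Δ assembly WITHOUT L2

* **`gm3_of_cruxes_coercive`** — the assembly of memo ROTOR-THEORY-21 §301 with the shell-coercivity constant `ĝ > 0` as a
  parameter: for `L ≥ 4`, `0 < Δ < 1`, `0 < ρ`, a ground profile with `T⁺ < 2ε₁`, coercivity `ĝ Σ_S|y|²/(ΔW) ≤ Re⟨y,Q̃(T⁺)y⟩`,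
  the three β-free cruxes `TrialGapAbs c`, `LowShellGFormAbs a`, `OffPoleTailAbs b`, `DenMinRest ρ` and the side condition
  `(1 + κ_EΔ/ĝ)·η_eff·(a + b/ρ) < c` give `GM3Fibre L Δ` (`ktAssemblyAbs_holds` is the case `ĝ = ĝ₀` supplied by `L2Quant`).
* **`gm3_of_cruxes_smallDelta`** — with the ELEMENTARY constant `ĝ = 1 − Δκ_E` of `shell_coercive_elementary` (no LEMMA L2/κ₀,
  no THEOREM G2): whenever `Δκ_E < 1` (≈ `Δ < .55`) and `η_eff·(a + b/ρ)/(1 − Δκ_E) < c`, the three lattice-sum cruxes and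
  `DenMinRest ρ` ALONE imply `GM3Fibre L Δ`.  (Numerically this closes for `Δ ≲ .3` with the theory seat's measured constants.)
Prover seat `hubbard-h0-rotor-p1` g22; helper for stmt-HubbardSuperconductivity-19089 (`--supports`).
-/

set_option linter.dupNamespace false
set_option autoImplicit false

noncomputable section

open scoped BigOperators
open Complex Matrix

namespace Summit.HubbardSuperconductivity.HubbardSuperconductivity.Theorems.AnisotropyChord.Transfer.Fibre3

variable (L : ℕ) [NeZero L]

/-- **the GM₃ assembly with a general shell constant `ĝ`.** [folklore] -/
theorem gm3_of_cruxes_coercive (hL4 : 4 ≤ L) {Δ : ℝ} (hΔ0 : 0 < Δ) (hΔ1 : Δ < 1) (c a b : ℝ) {ρ : ℝ} (hρ : 0 < ρ)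
    {ĝ : ℝ} (hĝ : 0 < ĝ) {lam2 : ℝ} {f : Tor L → ℝ} (hf : IsGroundTwoMagnon L Δ lam2 f)
    (hT2 : Tplus L Δ f < 2 * eps1 L)
    (hcoer : ∀ y : Ssub L → ℂ, ĝ * ∑ s : Ssub L, ‖y s‖ ^ 2 / (Δ * (Wcount L s.1 : ℝ))
      ≤ (star y ⬝ᵥ Qtilde L (Tplus L Δ f) Δ *ᵥ y).re)
    (hside : (1 + kappaE L Δ f * Δ / ĝ) * etaEff L lam2 * (a + b / ρ) < c)
    (hKT1 : TrialGapAbs L Δ c) (hKT2a : LowShellGFormAbs L Δ a) (hKT2b : OffPoleTailAbs L Δ b)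
    (hden : DenMinRest L Δ ρ) : GM3Fibre L Δ := by
  have hL2 : 2 ≤ L := by omega
  have hε := eps1_pos L hL4
  set T := Tplus L Δ f with hT
  have hT0 : 0 < T := Tplus_pos L hL2 hΔ1 hf
  have hg0 : 0 < 2 * eps1 L - T := by linarith
  -- STEP 1: shell positivity at T⁺
  have hQ : ∀ y : Ssub L → ℂ, y ≠ 0 → 0 < (star y ⬝ᵥ Qtilde L T Δ *ᵥ y).re := by
    intro y hy
    have h1 := hcoer y
    have h2 := shell_weighted_sum_pos L hΔ0 hy
    have := mul_pos hĝ h2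
    linarith
  -- STEP 2: the master inequality for Ψ¹
  set Ψ := trialK1 L f with hΨ
  have hsym := isSymm_trialK1 L hf
  have hD := trialK1_D L hf
  have hβ := ip_vfun_trialK1_ne_zero L hL2 hf
  have hE : 0 ≤ eps1 L + T := by linarith
  have hMI := master_inequality_hom L hL4 hΔ0 hE hT2 ĝ hĝ hcoer Ψ hsym hD hβ
  set N := trialGapN1 L Δ f with hN
  have hNeq := trialGapN1_eq L Δ f
  set R := resid L Δ f with hR
  have hReq : R = residual L T Δ Ψ := rfl
  set G := (Gform L T R R).re with hG
  set U := Uunit L Δ f with hU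
  set η := etaEff L lam2 with hη
  set fac := 1 + kappaE L Δ f * Δ / ĝ with hfac
  have hfac_eq : fac = 1 + (3 * eps1 L / (2 * eps1 L - T)) * Δ / ĝ := rfl
  have hU0 : 0 < U := by
    rw [hU]; unfold Uunit
    have : (0 : ℝ) < L := by exact_mod_cast (show 0 < L by omega)
    positivity
  have hκ : 0 ≤ 3 * eps1 L / (2 * eps1 L - T) := div_nonneg (by linarith) hg0.le
  have hfac0 : 0 ≤ fac := by
    rw [hfac_eq]
    have : 0 ≤ (3 * eps1 L / (2 * eps1 L - T)) * Δ / ĝ := by positivity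
    linarith
  rw [← hNeq, ← hReq, ← hfac_eq] at hMI
  -- STEP 3: the low/rest split
  have hm : 0 < ρ * (2 * eps1 L - T) := mul_pos hρ hg0
  have hsplit := re_Gform_le_split L hL4 T R hm (fun k₂ k₃ hp hl => hden lam2 f hf k₂ k₃ hp hl)
  have h1 : c * U ≤ N := hKT1 lam2 f hf
  have h2 : lowGForm L Δ f ≤ a * η * U := hKT2a lam2 f hf
  have h3 : (ip L R R).re - polePart L Δ f - lowNormPart L Δ f ≤ b * η * (2 * eps1 L - T) * U := hKT2b lam2 f hf
  have hsplit' : G ≤ lowGForm L Δ f + ((ip L R R).re - polePart L Δ f - lowNormPart L Δ f) / (ρ * (2 * eps1 L - T)) := by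
    rw [hG]; unfold lowGForm polePart lowNormPart; exact hsplit
  have h4 : ((ip L R R).re - polePart L Δ f - lowNormPart L Δ f) / (ρ * (2 * eps1 L - T)) ≤ b * η * U / ρ := by
    rw [div_le_iff₀ hm]
    calc (ip L R R).re - polePart L Δ f - lowNormPart L Δ f ≤ b * η * (2 * eps1 L - T) * U := h3
      _ = b * η * U / ρ * (ρ * (2 * eps1 L - T)) := by field_simp
  have h5 : G ≤ η * U * (a + b / ρ) := by
    have : a * η * U + b * η * U / ρ = η * U * (a + b / ρ) := by ring
    linarith [hsplit', h2, h4]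
  -- STEP 4: arithmetic
  have h6 : fac * G ≤ fac * (η * U * (a + b / ρ)) := mul_le_mul_of_nonneg_left h5 hfac0
  have hpos : 0 < N - fac * G := by
    have hside' : fac * η * (a + b / ρ) * U < c * U := mul_lt_mul_of_pos_right hside hU0
    nlinarith [h1, h6, hside']
  have hβpos : 0 < ‖ip L (vfun L) Ψ‖ ^ 2 / (3 * ((L : ℝ) ^ 2) ^ 2) := by
    have : 0 < ‖ip L (vfun L) Ψ‖ := norm_pos_iff.mpr hβ
    have hLpos : (0 : ℝ) < L := by exact_mod_cast (show 0 < L by omega)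
    positivity
  have hPhi : T < Phi L T Δ := by
    by_contra h
    have h' : Phi L T Δ - T ≤ 0 := by linarith
    have := mul_nonpos_of_nonneg_of_nonpos hβpos.le h'
    linarith [hMI]
  exact gm3Fibre_of_checks L hL4 hΔ0.ne' T hT2 hQ hPhi ⟨prodState L f, prodState_admissible L hL2 hf, le_rfl⟩

/-- **THE SMALL-Δ ASSEMBLY WITHOUT L2:** for `L ≥ 4`, `0 < Δ < 1`, `0 < ρ`, a ground profile with `T⁺ < 2ε₁` and
`Δ·κ_E < 1`, `κ_E = 3ε₁/(2ε₁ − T⁺)`, the side condition `η_eff·(a + b/ρ)/(1 − Δκ_E) < c`, the three β-free cruxes and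
`DenMinRest ρ` imply `GM3Fibre L Δ` — with NO shell-coercivity hypothesis (the elementary `1 − Δκ_E` replaces `ĝ₀`).
[folklore] -/
theorem gm3_of_cruxes_smallDelta (hL4 : 4 ≤ L) {Δ : ℝ} (hΔ0 : 0 < Δ) (hΔ1 : Δ < 1) (c a b : ℝ) {ρ : ℝ} (hρ : 0 < ρ)
    {lam2 : ℝ} {f : Tor L → ℝ} (hf : IsGroundTwoMagnon L Δ lam2 f) (hT2 : Tplus L Δ f < 2 * eps1 L)
    (hsmall : Δ * kappaE L Δ f < 1)
    (hside : etaEff L lam2 * (a + b / ρ) / (1 - Δ * kappaE L Δ f) < c)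
    (hKT1 : TrialGapAbs L Δ c) (hKT2a : LowShellGFormAbs L Δ a) (hKT2b : OffPoleTailAbs L Δ b)
    (hden : DenMinRest L Δ ρ) : GM3Fibre L Δ := by
  have hL2 : 2 ≤ L := by omega
  have hε := eps1_pos L hL4
  have hT0 : 0 < Tplus L Δ f := Tplus_pos L hL2 hΔ1 hf
  set ĝ : ℝ := 1 - Δ * kappaE L Δ f with hĝdef
  have hĝ : 0 < ĝ := by rw [hĝdef]; linarith
  have hcoer : ∀ y : Ssub L → ℂ, ĝ * ∑ s : Ssub L, ‖y s‖ ^ 2 / (Δ * (Wcount L s.1 : ℝ))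
      ≤ (star y ⬝ᵥ Qtilde L (Tplus L Δ f) Δ *ᵥ y).re := by
    intro y
    have h := shell_coercive_elementary L hL4 hΔ0 (T := Tplus L Δ f) (by linarith) hT2 y
    rw [hĝdef]; unfold kappaE; exact h
  have hfac : (1 + kappaE L Δ f * Δ / ĝ) = 1 / (1 - Δ * kappaE L Δ f) := by
    have hne : 1 - Δ * kappaE L Δ f ≠ 0 := by linarith
    have hne' : 1 - kappaE L Δ f * Δ ≠ 0 := by rw [mul_comm]; exact hne
    rw [hĝdef]
    field_simp
    ring
  have hside' : (1 + kappaE L Δ f * Δ / ĝ) * etaEff L lam2 * (a + b / ρ) < c := by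
    rw [hfac]
    calc 1 / (1 - Δ * kappaE L Δ f) * etaEff L lam2 * (a + b / ρ)
        = etaEff L lam2 * (a + b / ρ) / (1 - Δ * kappaE L Δ f) := by ring
      _ < c := hside
  exact gm3_of_cruxes_coercive L hL4 hΔ0 hΔ1 c a b hρ hĝ hf hT2 hcoer hside' hKT1 hKT2a hKT2b hden

end Summit.HubbardSuperconductivity.HubbardSuperconductivity.Theorems.AnisotropyChord.Transfer.Fibre3

end
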